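import Summits.Parity.GeneralizedHardyLittlewood.Theorems.PrimeLevelFamEdgeMomentsBeyondDiagonalDiagDecorShiftedBlockDecorTwo
import HarnessLib

/-!
# Route `PrimeLevelFamEdge`, crux K_A `MomentsBeyondDiagonal` (stmt-Parity-20007), line «petersson_layers» v4, stub `stub_diag`:
# **the TWO-SIDED decorated shifted block at the level of the Selberg form (part 1: the `(log g)^t` pieces):
# `Sel(τD₁(k₁)ℓ⁺(k₁)^{r₁}·τD₂(k₂)ℓ⁺(k₂)^{r₂}·B^p) = (π²/6)²(∫₀¹(λ−u)^pR^{(1)}_{r₁}R^{(2)}_{r₂})·log^{p+r₁+r₂}M·log M/log^{s₁+s₂}M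
# + O(log^{p+r₁+r₂}M/log^{s₁+s₂}M)`, and the instance `D₁ = D₂ = P₂` of order `(2,2)`**

Census R3(ii), ANALYTIC HALF; the two-sided twin of `…DiagDecorShiftedBlockDecor` / `…DiagDecorShiftedBlockDecorSel` (p825085,
p825169: ONE decorated coordinate), on top of the two-sided harmonic core `…DiagDecorShiftedBlockDecorTwo`. Needed from order
`(2,2)` on (`…DiagDecorOrderRungTwoHecke.heckeSum_orderTwoTwo_eq`: the two-sided decoration `τP₂(k₁)·τP₂(k₂)` in `3S₂² − 2S₄`),
and for every higher order (`…DiagDecorOrderHecke`: separable monomials `M_t(k₁)M_{t′}(k₂)L^m`). Same proofs as the one-sided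
files with the undecorated coordinate `𝒮^{[r₂]}` (master family `((X^rP)″, 2)`, crude size `abs_shiftedCoord_le`) replaced by a
second decorated coordinate with its own master family `(R^{(2)}_r, s₂)` (crude size from `abs_profileCoord_crude_le`):

* `abs_collapseShiftedDecorTwo_logPow_le` — the `(log g)^t` pieces (`t ≥ 1`) are `O(log^{t+q+r₁+r₂}M/log^{s₁+s₂}M)`;
* `selbergBlockDecorTwo_expand` — exact expansion along `−log g`;
* `abs_selbergBlockDecorTwo_sub_le` — **the two-sided block asymptotic displayed in the title**;
* `abs_selbergBlockPrimeSqTwo_sub_le` — **the instance `D₁ = D₂ = P₂`** (`R_r = −2X^rP`, `s = 0` twice):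
  `Sel(τP₂ℓ⁺^{r₁}·τP₂ℓ⁺^{r₂}·B^p) = (π²/6)²(∫₀¹(λ−u)^p(−2u^{r₁}P)(−2u^{r₂}P))·log^{p+r₁+r₂}M·log M + O(log^{p+r₁+r₂}M)` — with
  `…DiagDecorShiftedLpow` / `…DiagDecorShiftedP2Lpow` this evaluates every main-term monomial family of order `(2,2)` except the
  `M_4`-decorated ones, which carry no top-order main term.

Def-free; theorems only. Helper `--supports stmt-Parity-20007`; closes nothing; K_A, K_B and the Parity summit are NOT
proved; nothing about Landau–Siegel zeros.

## References
* E. Kowalski, P. Michel, J. VanderKam, J. reine angew. Math. 526 (2000), (23)–(28) pp. 13–15 and Prop. 5.1 p. 18.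
  [cite: KowalskiMichelVanderKam2000, (23)–(28) — derivation (diagonal main term in real Selberg coordinates)]
-/

noncomputable section

open scoped Real ArithmeticFunction.Moebius
open Finset ArithmeticFunction Polynomial MeasureTheory intervalIntegral

namespace Summit.Parity.GeneralizedHardyLittlewood.Theorems.MomentsBeyondDiagonal.DiagKernel

open Literature.NumberTheory.LFunctions Literature.NumberTheory.LFunctions.KMV2000
open MollifierMainTerm (W)
open SelbergCoord (kappa)
open Literature.NumberTheory.Sieve (one_le_log_of_three_le)
open Summit.Parity.GeneralizedHardyLittlewood.Theorems.BeyondDiagonalBeatsQuarter.KernelFormXSq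
  (mainConst divWeight divWeight_nonneg mainConst_nonneg abs_W_le sum_kappa_divWeight_sq_div_le)

/-- `κ(n) ≥ 0`. [folklore] -/
private theorem kappa_nonneg₄ (n : ℕ) : 0 ≤ kappa n := by
  unfold kappa
  exact Finset.sum_nonneg fun p hp ↦ by
    have hp2 : (2 : ℝ) ≤ p := by exact_mod_cast (Nat.prime_of_mem_primeFactors hp).two_le
    exact div_nonneg (Real.log_nonneg (by linarith)) (by linarith)

/-! ### The `(log g)^t` pieces, both coordinates decorated -/


/-- **The `(log g)^t` pieces of a two-sided decorated shifted block are one logarithm small** (`t ≥ 1`; crude sizes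
`|T₁^{[r₁]}| ≤ K₁D(n)log^{r₁}M/log^{s₁}M`, `|T₂^{[r₂]}| ≤ K₂D(n)log^{r₂}M/log^{s₂}M`).
[cite: KowalskiMichelVanderKam2000, (23)–(28) — derivation (log g terms of the diagonal main term)] -/
theorem abs_collapseShiftedDecorTwo_logPow_le (P : ℝ[X]) (D₁ D₂ : ℕ → ℝ) (s₁ s₂ : ℕ) {t : ℕ}
    (ht : 1 ≤ t) (q r₁ r₂ : ℕ) {lam : ℝ} (hlam0 : 0 ≤ lam) (hlam1 : lam ≤ 1) {K₁ K₂ : ℝ} (hK₁ : 0 ≤ K₁) (hK₂ : 0 ≤ K₂)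
    (hb₁ : ∀ M : ℝ, 3 ≤ M → ∀ n : ℕ, n ≠ 0 → (n : ℝ) ≤ M →
      |∑ c ∈ Finset.range (P.natDegree + 1), P.coeff c *
          ((∑ k ∈ Icc 1 ⌊M / n⌋₊, (if k.Coprime n then W k else 0) * ((k.divisors.card : ℝ) * D₁ k) *
            Real.log (M / n / k) ^ (c + r₁)) / Real.log M ^ c)| ≤
        K₁ * divWeight n * Real.log M ^ r₁ / Real.log M ^ s₁)
    (hb₂ : ∀ M : ℝ, 3 ≤ M → ∀ n : ℕ, n ≠ 0 → (n : ℝ) ≤ M →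
      |∑ c ∈ Finset.range (P.natDegree + 1), P.coeff c *
          ((∑ k ∈ Icc 1 ⌊M / n⌋₊, (if k.Coprime n then W k else 0) * ((k.divisors.card : ℝ) * D₂ k) *
            Real.log (M / n / k) ^ (c + r₂)) / Real.log M ^ c)| ≤
        K₂ * divWeight n * Real.log M ^ r₂ / Real.log M ^ s₂) :
    ∃ C : ℝ, 0 < C ∧ ∀ M : ℝ, 3 ≤ M →
      |∑ c ∈ Icc 1 ⌊M⌋₊, ∑ g ∈ Icc 1 (⌊M⌋₊ / c), (μ g : ℝ) * c * Real.log g ^ t * (W (c * g) ^ 2 *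
          ((lam * Real.log M - Real.log (M / ((c * g : ℕ) : ℝ))) ^ q *
            (∑ c' ∈ Finset.range (P.natDegree + 1), P.coeff c' *
              ((∑ k ∈ Icc 1 ⌊M / ((c * g : ℕ) : ℝ)⌋₊, (if k.Coprime (c * g) then W k else 0) *
                ((k.divisors.card : ℝ) * D₁ k) * Real.log (M / ((c * g : ℕ) : ℝ) / k) ^ (c' + r₁)) / Real.log M ^ c')) *
            (∑ c' ∈ Finset.range (P.natDegree + 1), P.coeff c' *
              ((∑ k ∈ Icc 1 ⌊M / ((c * g : ℕ) : ℝ)⌋₊, (if k.Coprime (c * g) then W k else 0) * ((k.divisors.card : ℝ) * D₂ k) *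
                Real.log (M / ((c * g : ℕ) : ℝ) / k) ^ (c' + r₂)) / Real.log M ^ c'))))| ≤
        C * Real.log M ^ (t + q + r₁ + r₂) / Real.log M ^ (s₁ + s₂) := by
  set S₁ : ℝ → ℕ → ℝ := fun M n ↦ ∑ c' ∈ Finset.range (P.natDegree + 1), P.coeff c' *
    ((∑ k ∈ Icc 1 ⌊M / n⌋₊, (if k.Coprime n then W k else 0) * ((k.divisors.card : ℝ) * D₁ k) *
      Real.log (M / n / k) ^ (c' + r₁)) / Real.log M ^ c') with hS₁
  set S₂ : ℝ → ℕ → ℝ := fun M n ↦ ∑ c' ∈ Finset.range (P.natDegree + 1), P.coeff c' *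
    ((∑ k ∈ Icc 1 ⌊M / n⌋₊, (if k.Coprime n then W k else 0) * ((k.divisors.card : ℝ) * D₂ k) *
      Real.log (M / n / k) ^ (c' + r₂)) / Real.log M ^ c') with hS₂
  set A : ℝ := (∑' d : ℕ, (d : ℝ) ^ (-(5 / 4 : ℝ))) ^ 2 with hA
  have hA0 : 0 ≤ A := by positivity
  refine ⟨K₁ * K₂ * (48 * A * 3) + 1, by positivity, fun M hM ↦ ?_⟩
  set ℓ := Real.log M with hℓ
  have hℓ1 : 1 ≤ ℓ := one_le_log_of_three_le hM
  have hℓ0 : 0 < ℓ := by linarith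
  have hM0 : 0 < M := by linarith
  set N := ⌊M⌋₊ with hN
  have hN1 : 1 ≤ N := Nat.le_floor (by norm_num; linarith)
  have hlogN : Real.log N ≤ ℓ := Real.log_le_log (by exact_mod_cast hN1) (Nat.floor_le hM0.le)
  have hlogN0 : 0 ≤ Real.log N := Real.log_natCast_nonneg N
  set F : ℕ → ℝ := fun n ↦ (lam * ℓ - Real.log (M / n)) ^ q * S₁ M n * S₂ M n with hF
  have hgoal : |∑ c ∈ Icc 1 N, ∑ g ∈ Icc 1 (N / c), (μ g : ℝ) * c * Real.log g ^ t * (W (c * g) ^ 2 *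
      ((lam * ℓ - Real.log (M / ((c * g : ℕ) : ℝ))) ^ q * S₁ M (c * g) * S₂ M (c * g)))| ≤
      (K₁ * K₂ * (48 * A * 3) + 1) * ℓ ^ (t + q + r₁ + r₂) / ℓ ^ (s₁ + s₂) := by
    refine (abs_selbergCollapse_logPow_le ht N F).trans ?_
    have hterm : ∀ n ∈ Icc 1 N, |W n| * kappa n * |F n| ≤
        K₁ * K₂ * ℓ ^ (q + r₁ + r₂) / ℓ ^ (s₁ + s₂) * (kappa n * divWeight n ^ 2 / n) := by
      intro n hn
      have hn' := Finset.mem_Icc.1 hn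
      have hn0 : n ≠ 0 := by omega
      have hnM : (n : ℝ) ≤ M := le_trans (by exact_mod_cast hn'.2) (Nat.floor_le hM0.le)
      have hD := divWeight_nonneg n
      have hκ := kappa_nonneg₄ n
      have hW := abs_W_le n
      have hB : |(lam * ℓ - Real.log (M / n)) ^ q| ≤ ℓ ^ q := by
        rw [abs_pow]; exact pow_le_pow_left₀ (abs_nonneg _) (abs_lam_mul_log_sub_log_div_le hlam0 hlam1 hM hn0 hnM) q
      have hS := mul_le_mul (hb₁ M hM n hn0 hnM) (hb₂ M hM n hn0 hnM) (abs_nonneg _) (by positivity)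
      have hF' : |F n| ≤ ℓ ^ q * (K₁ * divWeight n * ℓ ^ r₁ / ℓ ^ s₁ * (K₂ * divWeight n * ℓ ^ r₂ / ℓ ^ s₂)) := by
        simp only [hF]
        rw [abs_mul, abs_mul, mul_assoc]
        exact mul_le_mul hB hS (by positivity) (by positivity)
      have hn0' : (0 : ℝ) < n := by exact_mod_cast Nat.pos_of_ne_zero hn0
      calc |W n| * kappa n * |F n|
          ≤ (n : ℝ)⁻¹ * kappa n * (ℓ ^ q * (K₁ * divWeight n * ℓ ^ r₁ / ℓ ^ s₁ * (K₂ * divWeight n * ℓ ^ r₂ / ℓ ^ s₂))) := by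
            gcongr
        _ = K₁ * K₂ * ℓ ^ (q + r₁ + r₂) / ℓ ^ (s₁ + s₂) * (kappa n * divWeight n ^ 2 / n) := by
            rw [pow_add, pow_add, pow_add]; field_simp
    have hsum : ∑ n ∈ Icc 1 N, |W n| * kappa n * |F n| ≤
        K₁ * K₂ * ℓ ^ (q + r₁ + r₂) / ℓ ^ (s₁ + s₂) * (48 * A * (3 * ℓ)) := by
      calc _ ≤ ∑ n ∈ Icc 1 N, K₁ * K₂ * ℓ ^ (q + r₁ + r₂) / ℓ ^ (s₁ + s₂) * (kappa n * divWeight n ^ 2 / n) :=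
            Finset.sum_le_sum hterm
        _ = K₁ * K₂ * ℓ ^ (q + r₁ + r₂) / ℓ ^ (s₁ + s₂) * ∑ n ∈ Icc 1 N, kappa n * divWeight n ^ 2 / n := by
            rw [Finset.mul_sum]
        _ ≤ K₁ * K₂ * ℓ ^ (q + r₁ + r₂) / ℓ ^ (s₁ + s₂) * (48 * A * (2 + Real.log N)) := by
            refine mul_le_mul_of_nonneg_left ?_ (by positivity)
            have := sum_kappa_divWeight_sq_div_le hN1
            rw [← hA] at this
            exact this
        _ ≤ K₁ * K₂ * ℓ ^ (q + r₁ + r₂) / ℓ ^ (s₁ + s₂) * (48 * A * (3 * ℓ)) := by gcongr; linarith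
    have hpow : Real.log N ^ (t - 1) ≤ ℓ ^ (t - 1) := pow_le_pow_left₀ hlogN0 hlogN _
    have hsum0 : 0 ≤ ∑ n ∈ Icc 1 N, |W n| * kappa n * |F n| :=
      Finset.sum_nonneg fun n _ ↦ by have := kappa_nonneg₄ n; positivity
    calc Real.log N ^ (t - 1) * ∑ n ∈ Icc 1 N, |W n| * kappa n * |F n|
        ≤ ℓ ^ (t - 1) * (K₁ * K₂ * ℓ ^ (q + r₁ + r₂) / ℓ ^ (s₁ + s₂) * (48 * A * (3 * ℓ))) :=
          mul_le_mul hpow hsum hsum0 (by positivity)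
      _ = K₁ * K₂ * (48 * A * 3) * (ℓ ^ (t - 1) * ℓ * ℓ ^ (q + r₁ + r₂)) / ℓ ^ (s₁ + s₂) := by ring
      _ = K₁ * K₂ * (48 * A * 3) * ℓ ^ (t + q + r₁ + r₂) / ℓ ^ (s₁ + s₂) := by
          rw [pow_sub_one_mul (by omega : t ≠ 0) ℓ, ← pow_add, show t + (q + r₁ + r₂) = t + q + r₁ + r₂ by ring]
      _ ≤ (K₁ * K₂ * (48 * A * 3) + 1) * ℓ ^ (t + q + r₁ + r₂) / ℓ ^ (s₁ + s₂) := by gcongr; linarith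
  simpa only [hS₁, hS₂] using hgoal


end Summit.Parity.GeneralizedHardyLittlewood.Theorems.MomentsBeyondDiagonal.DiagKernel

end
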